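import Mathlib
import Summits.MatrixMultiplication.MatrixMultiplication.Theorems.SnSubsetDichotomyPolynomialSlackPermBernstein
import Summits.MatrixMultiplication.MatrixMultiplication.Theorems.SnSubsetDichotomyPolynomialSlackPairHeavyMass

/-!
# Large deviations of a depleted linear statistic on a quotient set

Crux `Summit.MatrixMultiplication.MatrixMultiplication.Theses.SnSubsetDichotomy.PolynomialSlack`
(item `stmt-MatrixMultiplication-8306`), level-one programme, line transport-split-hull
(lead c8, handle H2 beyond the 5/8 step). For a pair `X, Y ⊆ S_n` with `(x,y) ↦ x⁻¹y`
injective on `X × Y` the quotient set `A = X⁻¹Y` has `|A| = |X||Y|` (`card_image₂_of_injOn'`)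
and profile `d(i,j) = #{a ∈ A : a j = i}/|A|` (`pairMarginal_eq_marginal_image₂`). For a
weight `0 ≤ w ≤ m` the linear statistic `g(π) = Σ_j w (π j) j` has `S_n`-mean
`ḡ = Σ_{ij} w i j / n` and `A`-mean `Σ_{ij} d i j · w i j`. If the `A`-mean is depleted by
`t > 0` below `ḡ`, Markov's inequality on `A` puts at least `|A|·t/(2ḡ)` elements of `A` in
the lower tail `{g ≤ ḡ - t/2}`, while the permutation Bernstein inequality
`card_permutedSum_tail_le` bounds that tail by `2·n!·exp(-(t²/4)/V)` with
`V = 32(1 + log n)·Σw²/n + 4mt`; hence `t²/4 ≤ V·log(4Kḡ/t)`, `K = n!/(|X||Y|)`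
(`pair_depletion_bernstein`).
-/

namespace Summit.MatrixMultiplication.MatrixMultiplication.Theorems.PolynomialSlack

set_option linter.dupNamespace false

open scoped BigOperators

/-- **Large deviations of a depleted nonnegative linear statistic on a quotient set.** For
non-empty `X, Y ⊆ S_n` (`n ≥ 1`) with `(x,y) ↦ x⁻¹y` injective on `X × Y`, profile
`d(i,j) = #{(x,y) ∈ X × Y : y j = x i}/(|X||Y|)`, a weight `0 ≤ w ≤ m` and `t > 0` with
`Σ d·w ≤ Σ w/n - t`, one has
`t²/4 ≤ (32(1 + log n)·Σw²/n + 4mt)·log(4·(n!/(|X||Y|))·(Σ w/n)/t)`.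
Proof: `d` is the normalised marginal of the quotient set `A = X⁻¹Y` (`|A| = |X||Y|`), so
`Σ_{a ∈ A} g a = |A|·Σ d·w ≤ |A|(ḡ - t)` for `g(π) = Σ_j w (π j) j`, `ḡ = Σ w/n`; Markov
gives `|A|·t/2 ≤ ḡ·#{a ∈ A : g a ≤ ḡ - t/2}`, and this lower tail is bounded by
`card_permutedSum_tail_le` at deviation `t/2`. [folklore] -/
theorem pair_depletion_bernstein {n : ℕ} (hn : 1 ≤ n) (X Y : Finset (Equiv.Perm (Fin n)))
    (hX : X.Nonempty) (hY : Y.Nonempty)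
    (hinj : Set.InjOn (fun xy : Equiv.Perm (Fin n) × Equiv.Perm (Fin n) => xy.1⁻¹ * xy.2)
      (↑X ×ˢ ↑Y : Set (Equiv.Perm (Fin n) × Equiv.Perm (Fin n))))
    (d : Fin n → Fin n → ℝ)
    (hd : ∀ i j, d i j = (((X ×ˢ Y).filter fun xy => xy.2 j = xy.1 i).card : ℝ) / (X.card * Y.card : ℕ))
    (w : Fin n → Fin n → ℝ) (m t : ℝ) (hw0 : ∀ i j, 0 ≤ w i j) (hwm : ∀ i j, w i j ≤ m) (ht : 0 < t)
    (hdep : ∑ i : Fin n, ∑ j : Fin n, d i j * w i j ≤ (∑ i : Fin n, ∑ j : Fin n, w i j) / n - t) :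
    t ^ 2 / 4 ≤ (32 * (1 + Real.log n) * (∑ i : Fin n, ∑ j : Fin n, w i j ^ 2) / n + 4 * m * t) *
      Real.log (4 * ((n.factorial : ℝ) / (X.card * Y.card : ℕ)) *
        ((∑ i : Fin n, ∑ j : Fin n, w i j) / n) / t) := by
  classical
  /- (0) the quotient set `A = X⁻¹Y`: non-empty, of size `α = |X||Y| > 0`, with marginals
  `#{a ∈ A : a j = i} = α · d i j` -/
  set A : Finset (Equiv.Perm (Fin n)) :=
    Finset.image₂ (fun x y : Equiv.Perm (Fin n) => x⁻¹ * y) X Y with hA_def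
  have hA : A.Nonempty := hX.image₂ hY
  have hcard : A.card = X.card * Y.card := card_image₂_of_injOn' hinj
  have hmarg : ∀ i j : Fin n, (((X ×ˢ Y).filter fun xy => xy.2 j = xy.1 i).card : ℝ) =
      ((A.filter fun a => a j = i).card : ℝ) := fun i j => by
    exact_mod_cast pairMarginal_eq_marginal_image₂ hinj i j
  have hnR : (0 : ℝ) < n := by exact_mod_cast hn
  set α : ℝ := ((X.card * Y.card : ℕ) : ℝ) with hα
  have hαA : (A.card : ℝ) = α := by rw [hα, hcard]
  have hα0 : 0 < α := by rw [← hαA]; exact_mod_cast hA.card_pos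
  have hcell : ∀ i j : Fin n, α * d i j = ((A.filter fun a => a j = i).card : ℝ) :=
    fun i j => by
      rw [hd i j, hmarg i j]
      exact mul_div_cancel₀ _ hα0.ne'
  have hd0 : ∀ i j, 0 ≤ d i j := fun i j => by
    rw [hd i j]; exact div_nonneg (Nat.cast_nonneg _) hα0.le
  /- (1) the mean `gbar = Σ w / n ≥ t > 0` and the quadratic sum `Q = Σ w² > 0` -/
  set gbar : ℝ := (∑ i : Fin n, ∑ j : Fin n, w i j) / n with hgbar
  set Q : ℝ := ∑ i : Fin n, ∑ j : Fin n, w i j ^ 2 with hQ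
  have hdw0 : 0 ≤ ∑ i : Fin n, ∑ j : Fin n, d i j * w i j :=
    Finset.sum_nonneg fun i _ => Finset.sum_nonneg fun j _ => mul_nonneg (hd0 i j) (hw0 i j)
  have hgbart : t ≤ gbar := by linarith
  have hgbar0 : 0 < gbar := ht.trans_le hgbart
  have hQ0 : 0 < Q := by
    have hQnn : 0 ≤ Q :=
      Finset.sum_nonneg fun i _ => Finset.sum_nonneg fun j _ => sq_nonneg (w i j)
    rcases hQnn.lt_or_eq with h | h
    · exact h
    exfalso
    have hw : ∀ i j, w i j = 0 := fun i j => by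
      have h1 := (Finset.sum_eq_zero_iff_of_nonneg fun i _ =>
        Finset.sum_nonneg fun j _ => sq_nonneg (w i j)).1 h.symm i (Finset.mem_univ _)
      have h2 := (Finset.sum_eq_zero_iff_of_nonneg fun j _ => sq_nonneg (w i j)).1 h1 j
        (Finset.mem_univ _)
      exact (pow_eq_zero_iff two_ne_zero).1 h2
    have : gbar = 0 := by simp [hgbar, hw]
    linarith
  have hm : 0 ≤ m := (hw0 ⟨0, hn⟩ ⟨0, hn⟩).trans (hwm _ _)
  /- (2) double counting: `Σ_{a ∈ A} g a = α · Σ d·w ≤ α (gbar - t)` for the statistic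
  `g a = Σ_j w (a j) j` -/
  have hdc : ∑ a ∈ A, ∑ j : Fin n, w (a j) j = α * ∑ i : Fin n, ∑ j : Fin n, d i j * w i j := by
    calc ∑ a ∈ A, ∑ j : Fin n, w (a j) j = ∑ j : Fin n, ∑ a ∈ A, w (a j) j := Finset.sum_comm
      _ = ∑ j : Fin n, ∑ i : Fin n, ((A.filter fun a => a j = i).card : ℝ) * w i j := by
          refine Finset.sum_congr rfl fun j _ => ?_
          calc ∑ a ∈ A, w (a j) j = ∑ i : Fin n, ∑ a ∈ A with a j = i, w i j :=
                (Finset.sum_fiberwise' A (fun a => a j) (fun i => w i j)).symm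
            _ = _ := Finset.sum_congr rfl fun i _ => by rw [Finset.sum_const, nsmul_eq_mul]
      _ = ∑ i : Fin n, ∑ j : Fin n, ((A.filter fun a => a j = i).card : ℝ) * w i j :=
          Finset.sum_comm
      _ = α * ∑ i : Fin n, ∑ j : Fin n, d i j * w i j := by
          rw [Finset.mul_sum]
          refine Finset.sum_congr rfl fun i _ => ?_
          rw [Finset.mul_sum]
          refine Finset.sum_congr rfl fun j _ => ?_
          rw [← mul_assoc, hcell i j]
  have hsumA : ∑ a ∈ A, ∑ j : Fin n, w (a j) j ≤ α * (gbar - t) := by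
    rw [hdc]; exact mul_le_mul_of_nonneg_left hdep hα0.le
  /- (3) Markov on `A`: the lower tail `Good = {a ∈ A : g a ≤ gbar - t/2}` satisfies
  `α·t/2 ≤ gbar·|Good|` -/
  have hsplit := Finset.sum_filter_add_sum_filter_not A
    (fun a => ∑ j : Fin n, w (a j) j ≤ gbar - t / 2) (fun a => ∑ j : Fin n, w (a j) j)
  have hcsplit := Finset.card_filter_add_card_filter_not (s := A)
    (fun a => ∑ j : Fin n, w (a j) j ≤ gbar - t / 2)
  have hbad : ((A.filter fun a => ¬ (∑ j : Fin n, w (a j) j ≤ gbar - t / 2)).card : ℝ) *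
        (gbar - t / 2) ≤
      ∑ a ∈ A with ¬ (∑ j : Fin n, w (a j) j ≤ gbar - t / 2), ∑ j : Fin n, w (a j) j := by
    have h := Finset.card_nsmul_le_sum
      (A.filter fun a => ¬ (∑ j : Fin n, w (a j) j ≤ gbar - t / 2))
      (fun a => ∑ j : Fin n, w (a j) j) (gbar - t / 2)
      (fun a ha => (not_le.1 (Finset.mem_filter.1 ha).2).le)
    rwa [nsmul_eq_mul] at h
  have hgood0 :
      0 ≤ ∑ a ∈ A with (∑ j : Fin n, w (a j) j ≤ gbar - t / 2), ∑ j : Fin n, w (a j) j :=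
    Finset.sum_nonneg fun a _ => Finset.sum_nonneg fun j _ => hw0 _ _
  have hBd : ((A.filter fun a => ¬ (∑ j : Fin n, w (a j) j ≤ gbar - t / 2)).card : ℝ) =
      α - ((A.filter fun a => ∑ j : Fin n, w (a j) j ≤ gbar - t / 2).card : ℝ) := by
    rw [← hαA, ← hcsplit]
    push_cast
    ring
  rw [hBd] at hbad
  have hGt : (0 : ℝ) ≤ ((A.filter fun a => ∑ j : Fin n, w (a j) j ≤ gbar - t / 2).card : ℝ) * t :=
    mul_nonneg (Nat.cast_nonneg _) ht.le
  have hGood_card :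
      α * t / 2 ≤ ((A.filter fun a => ∑ j : Fin n, w (a j) j ≤ gbar - t / 2).card : ℝ) * gbar := by
    linarith [hbad, hsplit, hgood0, hsumA, hGt]
  /- (4) the Bernstein bound `card_permutedSum_tail_le` for the lower tail at deviation `t/2`,
  applied to `a j i := w i j` (so that `Σ_j a j (π j) = g π`, `Σ a = Σ w`, `Σ a² = Σ w²`) -/
  have hB := card_permutedSum_tail_le (n := n) m (fun j i => w i j)
    (fun j i => by rw [abs_of_nonneg (hw0 i j)]; exact hwm i j) (t / 2) (by linarith)
  have hWc : ∑ j : Fin n, ∑ i : Fin n, w i j = ∑ i : Fin n, ∑ j : Fin n, w i j := Finset.sum_comm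
  have hQc : ∑ j : Fin n, ∑ i : Fin n, w i j ^ 2 = Q := Finset.sum_comm
  have h8 : (8 : ℝ) * m * (t / 2) = 4 * m * t := by ring
  have ht2 : (t / 2) ^ 2 = t ^ 2 / 4 := by ring
  rw [hWc, hQc, h8, ht2] at hB
  set V : ℝ := 32 * (1 + Real.log n) * Q / n + 4 * m * t with hV
  have hsub : (A.filter fun a => ∑ j : Fin n, w (a j) j ≤ gbar - t / 2) ⊆
      Finset.univ.filter fun π : Equiv.Perm (Fin n) =>
        t / 2 ≤ |∑ j : Fin n, w (π j) j - (∑ i : Fin n, ∑ j : Fin n, w i j) / n| := by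
    intro a ha
    rw [Finset.mem_filter] at ha ⊢
    refine ⟨Finset.mem_univ _, ?_⟩
    rw [abs_sub_comm]
    exact le_trans (by linarith [ha.2]) (le_abs_self _)
  have hGB : (((A.filter fun a => ∑ j : Fin n, w (a j) j ≤ gbar - t / 2).card : ℕ) : ℝ) ≤
      2 * (n.factorial : ℝ) * Real.exp (-(t ^ 2 / 4 / V)) :=
    le_trans (by exact_mod_cast Finset.card_le_card hsub) hB
  /- (5) bookkeeping: `exp((t²/4)/V) ≤ 4·K·gbar/t`, take logarithms, multiply by `V > 0` -/
  have hV0 : 0 < V := by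
    have hlog : 0 ≤ Real.log n := Real.log_nonneg (by exact_mod_cast hn)
    have h1 : 0 < 32 * (1 + Real.log n) * Q / n :=
      div_pos (mul_pos (mul_pos (by norm_num) (by linarith)) hQ0) hnR
    have h2 : 0 ≤ 4 * m * t := mul_nonneg (mul_nonneg (by norm_num) hm) ht.le
    linarith
  have hL0 : 0 < 4 * ((n.factorial : ℝ) / α) * gbar / t :=
    div_pos (mul_pos (mul_pos (by norm_num)
      (div_pos (by exact_mod_cast n.factorial_pos) hα0)) hgbar0) ht
  have hexp : Real.exp (t ^ 2 / 4 / V) ≤ 4 * ((n.factorial : ℝ) / α) * gbar / t := by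
    have h1 : α * t / 2 ≤ 2 * (n.factorial : ℝ) * Real.exp (-(t ^ 2 / 4 / V)) * gbar :=
      hGood_card.trans (mul_le_mul_of_nonneg_right hGB hgbar0.le)
    have hE := Real.exp_pos (t ^ 2 / 4 / V)
    have hEE : Real.exp (t ^ 2 / 4 / V) * Real.exp (-(t ^ 2 / 4 / V)) = 1 := by
      rw [← Real.exp_add, add_neg_cancel, Real.exp_zero]
    have h2 : Real.exp (t ^ 2 / 4 / V) * (α * t / 2) ≤ 2 * n.factorial * gbar := by
      calc Real.exp (t ^ 2 / 4 / V) * (α * t / 2)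
          ≤ Real.exp (t ^ 2 / 4 / V) *
              (2 * (n.factorial : ℝ) * Real.exp (-(t ^ 2 / 4 / V)) * gbar) :=
            mul_le_mul_of_nonneg_left h1 hE.le
        _ = (Real.exp (t ^ 2 / 4 / V) * Real.exp (-(t ^ 2 / 4 / V))) *
              (2 * n.factorial * gbar) := by
            ring
        _ = 2 * n.factorial * gbar := by rw [hEE, one_mul]
    rw [le_div_iff₀ ht,
      show 4 * ((n.factorial : ℝ) / α) * gbar = 2 * n.factorial * gbar * 2 / α by ring,
      le_div_iff₀ hα0]
    linarith
  have hlogE : t ^ 2 / 4 / V ≤ Real.log (4 * ((n.factorial : ℝ) / α) * gbar / t) :=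
    (Real.le_log_iff_exp_le hL0).2 hexp
  have hfin := (div_le_iff₀ hV0).1 hlogE
  rw [mul_comm] at hfin
  exact hfin

end Summit.MatrixMultiplication.MatrixMultiplication.Theorems.PolynomialSlack
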